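import Mathlib
import HarnessLib
import Literature.Analysis.FluidPDE.SelfSimilar
import Literature.Analysis.FluidPDE.VectorCalculus
import Literature.Analysis.FluidPDE.VorticityCalculus
import Literature.Analysis.FluidPDE.TaoLocalVelocityGradient
import Literature.Analysis.FluidPDE.DivFreeVectorPotential
import Summits.NavierStokesRegularity.NavierStokesRegularity.Theorems.UnthreadedDoorToroidalPotentialClosed
import Summits.NavierStokesRegularity.NavierStokesRegularity.Theorems.UnthreadedDoorAntidynamoSingleDegreeRungGradientBranch

/-!
# Route `UnthreadedDoor` / `ThreadingFlux`, crux `PoloidalLiouville` (stmt-NavierStokesRegularity-1222), antidynamo v2 skeleton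
# (sha16 `4ebf5683127b`), rung `stub_singleDegreeRung` (BC5), file 1/2: junk-robust kinematics «GRADIENT-PLUS-RADIAL FIELDS ARE UNTHREADED»

Support file (seat leafhand-ns-unthreadeddoor-1 g0, cell decomp-ns), `--supports stmt-NavierStokesRegularity-1222 --as helper`; theorems only;
continues `UnthreadedDoorAntidynamoSingleDegreeRungGradientBranch.lean` (p793685).  File 2/2 (`…SingleDegreeRungOfCrux`) draws the consequence
`PoloidalLiouville → StubSingleDegreeRung`.

THE POINT.  The registered rung `StubSingleDegreeRung` (skeleton l. 152; twinned VERBATIM below) asks that a bounded ancient duality-class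
solution, jointly smooth on `(−∞,0) × ℝ³`, each of whose slices has the single-degree form
`v t x = gradient φ x + (g ‖x − x₀‖ · P(x − x₀)) • (x − x₀)` — for SOME `g : ℝ → ℝ`, `φ : ℝ³ → ℝ`, NO regularity assumed, Mathlib's junk
`gradient` — have constant slices.  We prove that every such slice family is UNTHREADED about `x₀` (`⟪x − x₀, curl v(t) x⟫ = 0`), so the
rung follows from the crux `PoloidalLiouville` BY NAME (and hence from the wall `StubScalarLiouville` through the landed composition).  The
rung is therefore not an independent first target: it is literally the crux restricted to a sub-class.

THE KINEMATIC LEMMA (★ `inner_curl_eq_zero_of_eq_gradient_add_smul`, centre `0`; `…_sub` for a general centre).  Let `v ∈ C¹(ℝ³; ℝ³)` satisfy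
`v x = gradient φ x + h x • x` pointwise with ARBITRARY `φ, h : ℝ³ → ℝ`.  Then `⟪x, curl v x⟫ = 0` for all `x`.  Formally `curl ∇φ = 0` and
`curl (h • id) = ∇h × id ⊥ id`, but neither `φ` nor `h` need be differentiable anywhere in the right sense; the proof uses only the
smoothness of `v` and the topology of the differentiability set `D` of `φ`:
* CASE A (`inner_curl_eq_zero_of_gradient_repr_nhds`): on `U = interior D`, pull `φ` back along the radial projection `π(z) = (ρ/‖z‖) z`
  onto the sphere through `x₁`.  Since `∇φ = v − h • id` on `U` and `Dπ(z)` is tangent (`⟪π z, Dπ(z) k⟫ = 0`, tree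
  `inner_radialProj_fderiv_eq_zero`), the pull-back `Φ = φ ∘ π` has `DΦ(z) = ⟪v(π z), Dπ(z) ·⟫` — the rough radial part is killed — so
  `Φ ∈ C²` near `x₁` and `curl ∇Φ(x₁) = 0` (`curl_gradient_eq_zero_of_contDiffOn`, p793685).  With `Dπ(z) = (ρ/‖z‖) id + σ(z)⟪z,·⟫ ⊗ z`
  one gets `∇Φ = (ρ/‖z‖) • v∘π + β • id`, and first-order algebra (`curl_smul`, `curlCLM_smulRight`, rank-one curls `⟪y,·⟫ ⊗ u` are
  `⊥ y`) gives `⟪x₁, curl ∇Φ(x₁)⟫ = ⟪x₁, curl v(x₁)⟫`.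
* CASE B (`inner_curl_eq_zero_of_cross_eq_zero_nhds`): on `Dᶜ` the field is radial, `v = h • id`, a CLOSED condition (`v z × z = 0`),
  hence it holds on `closure Dᶜ ⊇ (closure U)ᶜ`; near such a point `v = k • id` with `k = ⟪z, v z⟫/‖z‖²` differentiable, so
  `⟪x, curl v x⟫ = 0` (`inner_curl_smul_id_eq_zero`).
* Assembly: `⟪·, curl v ·⟫` is continuous and vanishes on `U`, hence on `closure U`; off `closure U` Case B applies.

MAIN DECLARATIONS: §1 cross-product / rank-one-curl algebra; §2 the radial functions `ρ/‖y‖`, their derivatives `σ(z)⟪z,·⟫` and the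
radial coefficient's differentiability; `inner_curl_smul_id_eq_zero` (radial fields are unthreaded); §3 Case A; §4 Case B; §5 ★
`inner_curl_eq_zero_of_eq_gradient_add_smul` and ★ `inner_curl_eq_zero_of_eq_gradient_add_smul_sub` (general centre `x₀`).

HONEST LABEL: kinematics only; nothing here proves the rung, the wall `stub_scalarLiouville`, `PoloidalLiouville` (1222) or bears on NS
regularity.  [folklore]

References: G. Backus, Rev. Geophys. 24 (1986) §2 (Mie representation: toroidal fields `∇T × y`, radial fields); A. J. Majda,
A. L. Bertozzi, *Vorticity and Incompressible Flow* (CUP 2002) §1.1 (vector identities).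
-/

noncomputable section

-- the summit and its single sub-problem share the name (CONVENTIONS §1)
set_option linter.dupNamespace false

open scoped Topology InnerProductSpace RealInnerProductSpace ContDiff
open Filter Set Function Metric MeasureTheory
open Literature.Analysis.FluidPDE

namespace Summit.NavierStokesRegularity.NavierStokesRegularity.Theorems.PoloidalLiouville.Antidynamo

/-! ## §1 Algebra -/

/-- `⟪(c • y) × u, y⟫ = 0`. [folklore] -/
theorem inner_cross_smul_self_left (c : ℝ) (u y : EuclideanSpace ℝ (Fin 3)) :
    ⟪cross (c • y) u, y⟫ = 0 := by
  simp [cross, cross_apply, PiLp.inner_apply, Fin.sum_univ_three]; ring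

/-- `⟪u × (c • y), y⟫ = 0`. [folklore] -/
theorem inner_cross_smul_self_right (c : ℝ) (u y : EuclideanSpace ℝ (Fin 3)) :
    ⟪cross u (c • y), y⟫ = 0 := by
  simp [cross, cross_apply, PiLp.inner_apply, Fin.sum_univ_three]; ring

/-- `(c • z) × z = 0`. [folklore] -/
theorem cross_smul_self_left (c : ℝ) (z : EuclideanSpace ℝ (Fin 3)) : cross (c • z) z = 0 := by
  ext i
  fin_cases i <;> simp [cross]

/-- A vector with `a × b = 0`, `b ≠ 0`, is the multiple `(⟪b, a⟫ / ‖b‖²) • b` of `b`. [folklore] -/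
theorem eq_smul_of_cross_eq_zero {a b : EuclideanSpace ℝ (Fin 3)} (hb : b ≠ 0) (h : cross a b = 0) :
    a = (⟪b, a⟫ / ‖b‖ ^ 2) • b := by
  have hba : cross b a = 0 := by
    have : cross b a = -cross a b := by
      simp only [cross, ← neg_cross (WithLp.ofLp a) (WithLp.ofLp b), WithLp.toLp_neg]
    rw [this, h, neg_zero]
  have h1 := cross_cross_self b a
  rw [hba] at h1
  have h2 : (‖b‖ ^ 2) • a = ⟪b, a⟫ • b := by
    have : cross (0 : EuclideanSpace ℝ (Fin 3)) b = 0 := by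
      ext i; fin_cases i <;> simp [cross]
    rw [this] at h1
    exact (sub_eq_zero.1 h1.symm)
  have hb2 : ‖b‖ ^ 2 ≠ 0 := pow_ne_zero _ (norm_ne_zero_iff.2 hb)
  calc a = (‖b‖ ^ 2)⁻¹ • ((‖b‖ ^ 2) • a) := by rw [smul_smul, inv_mul_cancel₀ hb2, one_smul]
    _ = (⟪b, a⟫ / ‖b‖ ^ 2) • b := by rw [h2, smul_smul, inv_mul_eq_div]

/-- The Riesz vector of `c • ⟪y, ·⟫` is `c • y`. [folklore] -/
theorem toDual_symm_smul_innerSL (c : ℝ) (y : EuclideanSpace ℝ (Fin 3)) :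
    (InnerProductSpace.toDual ℝ (EuclideanSpace ℝ (Fin 3))).symm (c • innerSL ℝ y) = c • y := by
  apply (InnerProductSpace.toDual ℝ (EuclideanSpace ℝ (Fin 3))).injective
  rw [LinearIsometryEquiv.apply_symm_apply]
  ext w
  simp [InnerProductSpace.toDual_apply_apply]

/-- `D ∘ (ℓ ⊗ x) = ℓ ⊗ (D x)` for a linear map `D`. [folklore] -/
theorem comp_smulRight (D : EuclideanSpace ℝ (Fin 3) →L[ℝ] EuclideanSpace ℝ (Fin 3))
    (ℓ : EuclideanSpace ℝ (Fin 3) →L[ℝ] ℝ) (x : EuclideanSpace ℝ (Fin 3)) :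
    D.comp (ℓ.smulRight x) = ℓ.smulRight (D x) := by
  ext k
  simp [ContinuousLinearMap.smulRight_apply, map_smul]

/-- The curl of a rank-one Jacobian `(c⟪y,·⟫) ⊗ u` is orthogonal to `y`. [folklore] -/
theorem inner_curlCLM_smulRight_smul_innerSL (c : ℝ) (y u : EuclideanSpace ℝ (Fin 3)) :
    ⟪curlCLM ((c • innerSL ℝ y).smulRight u), y⟫ = 0 := by
  rw [curlCLM_smulRight, toDual_symm_smul_innerSL, inner_cross_smul_self_left]

/-- The curl of a rank-one Jacobian `(c⟪y,·⟫) ⊗ u` is orthogonal to `y` (flipped). [folklore] -/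
theorem inner_curlCLM_smulRight_smul_innerSL' (c : ℝ) (y u : EuclideanSpace ℝ (Fin 3)) :
    ⟪y, curlCLM ((c • innerSL ℝ y).smulRight u)⟫ = 0 := by
  rw [real_inner_comm, inner_curlCLM_smulRight_smul_innerSL]

/-! ## §2 The radial functions `s(y) = ρ/‖y‖` and the radial projection `π(y) = s(y) • y` -/

/-- The derivative of `y ↦ ρ/‖y‖` at `z ≠ 0` is the multiple `2 g'(‖z‖²)` of `⟪z, ·⟫`, `g(t) = ρ/√t`. [folklore] -/
theorem hasFDerivAt_div_norm (ρ : ℝ) {z : EuclideanSpace ℝ (Fin 3)} (hz : z ≠ 0) :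
    HasFDerivAt (fun y : EuclideanSpace ℝ (Fin 3) => ρ / ‖y‖)
      ((deriv (fun t : ℝ => ρ / Real.sqrt t) (‖z‖ ^ 2) * 2) • innerSL ℝ z) z := by
  have hq : HasFDerivAt (fun y : EuclideanSpace ℝ (Fin 3) => ‖y‖ ^ 2) (2 • innerSL ℝ z) z :=
    (hasStrictFDerivAt_norm_sq z).hasFDerivAt
  have ht0 : ‖z‖ ^ 2 ≠ 0 := pow_ne_zero _ (norm_ne_zero_iff.2 hz)
  have hg : DifferentiableAt ℝ (fun t : ℝ => ρ / Real.sqrt t) (‖z‖ ^ 2) := by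
    have h1 : DifferentiableAt ℝ Real.sqrt (‖z‖ ^ 2) := (Real.hasDerivAt_sqrt ht0).differentiableAt
    refine (differentiableAt_const ρ).div h1 ?_
    rw [Real.sqrt_sq (norm_nonneg z)]
    exact norm_ne_zero_iff.2 hz
  have hcomp := hg.hasDerivAt.comp_hasFDerivAt z hq
  have heq : ((fun t : ℝ => ρ / Real.sqrt t) ∘ fun y : EuclideanSpace ℝ (Fin 3) => ‖y‖ ^ 2) =
      fun y => ρ / ‖y‖ := by
    funext y
    simp only [comp_apply, Real.sqrt_sq (norm_nonneg y)]
  rw [heq] at hcomp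
  refine hcomp.congr_fderiv ?_
  ext w
  simp
  ring

/-- `y ↦ ρ/‖y‖` is smooth at `z ≠ 0`. [folklore] -/
theorem contDiffAt_div_norm (ρ : ℝ) {n : WithTop ℕ∞} {z : EuclideanSpace ℝ (Fin 3)} (hz : z ≠ 0) :
    ContDiffAt ℝ n (fun y : EuclideanSpace ℝ (Fin 3) => ρ / ‖y‖) z :=
  contDiffAt_const.div (contDiffAt_norm ℝ hz) (norm_ne_zero_iff.2 hz)

/-- `g(t) = ρ/√t` is `C²` on `(0, ∞)`. [folklore] -/
theorem contDiffOn_div_sqrt (ρ : ℝ) : ContDiffOn ℝ 2 (fun t : ℝ => ρ / Real.sqrt t) (Ioi 0) := by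
  intro t ht
  have ht0 : t ≠ 0 := ne_of_gt ht
  exact (contDiffAt_const.div (Real.contDiffAt_sqrt ht0) (Real.sqrt_ne_zero'.2 ht)).contDiffWithinAt

/-- The radial coefficient `z ↦ g'(‖z‖²)` is differentiable away from the origin. [folklore] -/
theorem differentiableAt_deriv_div_sqrt_norm_sq (ρ : ℝ) {z : EuclideanSpace ℝ (Fin 3)} (hz : z ≠ 0) :
    DifferentiableAt ℝ (fun y : EuclideanSpace ℝ (Fin 3) => deriv (fun t : ℝ => ρ / Real.sqrt t) (‖y‖ ^ 2)) z := by
  have hpos : 0 < ‖z‖ ^ 2 := by positivity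
  have h1 : ContDiffOn ℝ 1 (deriv fun t : ℝ => ρ / Real.sqrt t) (Ioi 0) :=
    (contDiffOn_div_sqrt ρ).deriv_of_isOpen isOpen_Ioi (by norm_num)
  have h2 : DifferentiableAt ℝ (deriv fun t : ℝ => ρ / Real.sqrt t) (‖z‖ ^ 2) :=
    (h1.differentiableOn one_ne_zero).differentiableAt (isOpen_Ioi.mem_nhds hpos)
  exact h2.comp z ((differentiableAt_id).norm_sq ℝ)

/-- RADIAL FIELDS ARE UNTHREADED: `⟪y, curl (k • id) y⟫ = 0` wherever the scalar `k` is differentiable. [folklore] -/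
theorem inner_curl_smul_id_eq_zero {k : EuclideanSpace ℝ (Fin 3) → ℝ} {y : EuclideanSpace ℝ (Fin 3)}
    (hk : DifferentiableAt ℝ k y) :
    ⟪y, curl (fun z : EuclideanSpace ℝ (Fin 3) => k z • z) y⟫ = 0 := by
  rw [show (fun z : EuclideanSpace ℝ (Fin 3) => k z • z) = fun z => k z • id z from rfl,
    curl_smul hk differentiableAt_id, curlCLM_smulRight]
  have h0 : curl (id : EuclideanSpace ℝ (Fin 3) → EuclideanSpace ℝ (Fin 3)) y = 0 := by
    rw [curl_eq_curlCLM, fderiv_id]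
    ext i; fin_cases i <;> simp [curlCLM_apply]
  rw [h0, smul_zero, zero_add, id, ← gradient]
  -- `⟪y, ∇k × y⟫ = det(y, ∇k, y) = 0`
  simp [cross, cross_apply, PiLp.inner_apply, Fin.sum_univ_three]; ring


/-! ## §3 Case A: the potential is differentiable on an open set — pull back along the radial projection -/

/-- CASE A (core, centre `0`).  Let `v` be `C¹` and suppose that on an open set `U` the function `φ` is differentiable with
`∇φ = v − h • id` pointwise (`h` arbitrary).  Then `⟪x₁, curl v x₁⟫ = 0` at every `x₁ ∈ U`, `x₁ ≠ 0`.  Proof: with `ρ = ‖x₁‖` and the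
radial projection `π(z) = (ρ/‖z‖) z`, the pull-back `Φ = φ ∘ π` has `DΦ(z) = ⟪v(π z), Dπ(z) ·⟫` (the radial part of `∇φ` is killed by
the tangency `⟪π z, Dπ(z) k⟫ = 0`), so `Φ ∈ C²` near `x₁` and `curl ∇Φ(x₁) = 0`; and `∇Φ = (ρ/‖z‖) v∘π + β • id` with `Dπ(x₁) = id + c ⟪x₁,·⟫ ⊗ x₁`,
whence `⟪x₁, curl ∇Φ(x₁)⟫ = ⟪x₁, curl v(x₁)⟫`. [folklore] -/
theorem inner_curl_eq_zero_of_gradient_repr_nhds {φ h : EuclideanSpace ℝ (Fin 3) → ℝ}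
    {v : EuclideanSpace ℝ (Fin 3) → EuclideanSpace ℝ (Fin 3)} {U : Set (EuclideanSpace ℝ (Fin 3))}
    (hU : IsOpen U) (hv : ContDiff ℝ 1 v) (hφd : ∀ z ∈ U, DifferentiableAt ℝ φ z)
    (hrep : ∀ z ∈ U, gradient φ z = v z - h z • z) {x₁ : EuclideanSpace ℝ (Fin 3)} (hx₁ : x₁ ∈ U)
    (hx0 : x₁ ≠ 0) : ⟪x₁, curl v x₁⟫ = 0 := by
  have hvd : ∀ z, DifferentiableAt ℝ v z := fun z => hv.differentiable one_ne_zero z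
  set ρ : ℝ := ‖x₁‖ with hρ
  have hρ0 : ρ ≠ 0 := norm_ne_zero_iff.2 hx0
  set s : EuclideanSpace ℝ (Fin 3) → ℝ := fun y => ρ / ‖y‖ with hs
  set π : EuclideanSpace ℝ (Fin 3) → EuclideanSpace ℝ (Fin 3) := fun y => (ρ / ‖y‖) • y with hπdef
  -- the radial coefficient of `∇s`
  set σ : EuclideanSpace ℝ (Fin 3) → ℝ := fun y => deriv (fun t : ℝ => ρ / Real.sqrt t) (‖y‖ ^ 2) * 2 with hσ
  have hsx : s x₁ = 1 := div_self hρ0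
  have hπx : π x₁ = x₁ := by
    show (ρ / ‖x₁‖) • x₁ = x₁
    rw [div_self hρ0, one_smul]
  have hsd : ∀ z : EuclideanSpace ℝ (Fin 3), z ≠ 0 → HasFDerivAt s (σ z • innerSL ℝ z) z :=
    fun z hz => hasFDerivAt_div_norm ρ hz
  have hπ' : ∀ z : EuclideanSpace ℝ (Fin 3), z ≠ 0 →
      HasFDerivAt π (s z • ContinuousLinearMap.id ℝ (EuclideanSpace ℝ (Fin 3)) + (σ z • innerSL ℝ z).smulRight z) z :=
    fun z hz => (hsd z hz).smul (hasFDerivAt_id z)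
  -- the open neighbourhood `N = {z ≠ 0} ∩ π⁻¹ U` of `x₁`
  have hπcont : ContinuousOn π {z | z ≠ 0} := fun z hz =>
    (contDiffAt_radialProj ρ (n := 0) hz).continuousAt.continuousWithinAt
  set N : Set (EuclideanSpace ℝ (Fin 3)) := {z | z ≠ 0} ∩ π ⁻¹' U with hN
  have hNo : IsOpen N := hπcont.isOpen_inter_preimage isOpen_ne hU
  have hx₁N : x₁ ∈ N := ⟨hx0, by rw [mem_preimage, hπx]; exact hx₁⟩
  -- `Φ = φ ∘ π` and its derivative `L z = ⟪v (π z), Dπ(z) ·⟫` on `N`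
  set Φ : EuclideanSpace ℝ (Fin 3) → ℝ := fun z => φ (π z) with hΦ
  set L : EuclideanSpace ℝ (Fin 3) → (EuclideanSpace ℝ (Fin 3) →L[ℝ] ℝ) :=
    fun z => (innerSL ℝ (v (π z))).comp (fderiv ℝ π z) with hL
  have hderiv : ∀ z ∈ N, HasFDerivAt Φ (L z) z := by
    intro z hz
    have hzU : π z ∈ U := hz.2
    have hπd : HasFDerivAt π (fderiv ℝ π z) z := (hπ' z hz.1).differentiableAt.hasFDerivAt
    have hφ' : HasFDerivAt φ
        ((InnerProductSpace.toDual ℝ (EuclideanSpace ℝ (Fin 3))) (gradient φ (π z))) (π z) :=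
      (hφd _ hzU).hasGradientAt.hasFDerivAt
    refine (hφ'.comp z hπd).congr_fderiv ?_
    ext k
    have htan : ⟪π z, fderiv ℝ π z k⟫ = 0 := inner_radialProj_fderiv_eq_zero ρ hz.1 k
    simp only [ContinuousLinearMap.coe_comp, comp_apply, InnerProductSpace.toDual_apply_apply, hL,
      innerSL_apply_apply, hrep _ hzU, inner_sub_left, real_inner_smul_left, htan, mul_zero, sub_zero]
  have hΦdiff : DifferentiableOn ℝ Φ N := fun z hz => (hderiv z hz).differentiableAt.differentiableWithinAt
  have hfd : ∀ z ∈ N, fderiv ℝ Φ z = L z := fun z hz => (hderiv z hz).fderiv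
  -- `L` is `C¹` on `N`, so `Φ ∈ C²(N)`
  have hπN : ContDiffOn ℝ ∞ π N := fun z hz => (contDiffAt_radialProj ρ hz.1).contDiffWithinAt
  have hL1 : ContDiffOn ℝ 1 L N := by
    have h1 : ContDiffOn ℝ 1 (fun z => innerSL ℝ (v (π z))) N :=
      ((innerSL ℝ (E := EuclideanSpace ℝ (Fin 3))).contDiff.comp hv).comp_contDiffOn
        (hπN.of_le (by norm_cast))
    have h2 : ContDiffOn ℝ 1 (fun z => fderiv ℝ π z) N := hπN.fderiv_of_isOpen hNo (by norm_cast)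
    exact h1.clm_comp h2
  have hΦ2 : ContDiffOn ℝ 2 Φ N := by
    rw [show (2 : WithTop ℕ∞) = 1 + 1 by norm_num, contDiffOn_succ_iff_fderiv_of_isOpen hNo]
    exact ⟨hΦdiff, fun h1ω => absurd h1ω (by simp), hL1.congr hfd⟩
  have hcurl0 : curl (gradient Φ) x₁ = 0 := curl_gradient_eq_zero_of_contDiffOn hNo hΦ2 hx₁N
  -- explicit form `∇Φ = A + B` on `N`: `A z = s z • v (π z)`, `B z = β z • z`, `β z = ⟪v (π z), z⟫ σ z`
  set A : EuclideanSpace ℝ (Fin 3) → EuclideanSpace ℝ (Fin 3) := fun z => s z • v (π z) with hA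
  set β : EuclideanSpace ℝ (Fin 3) → ℝ := fun z => ⟪v (π z), z⟫ * σ z with hβ
  set B : EuclideanSpace ℝ (Fin 3) → EuclideanSpace ℝ (Fin 3) := fun z => β z • z with hB
  have hgradΦ : ∀ z ∈ N, gradient Φ z = A z + B z := by
    intro z hz
    rw [gradient, hfd z hz]
    simp only [hL]
    rw [(hπ' z hz.1).fderiv]
    apply (InnerProductSpace.toDual ℝ (EuclideanSpace ℝ (Fin 3))).injective
    rw [LinearIsometryEquiv.apply_symm_apply]
    ext k
    simp only [ContinuousLinearMap.coe_comp, comp_apply, _root_.add_apply,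
      _root_.smul_apply, ContinuousLinearMap.coe_id', id_eq, ContinuousLinearMap.smulRight_apply,
      innerSL_apply_apply, InnerProductSpace.toDual_apply_apply, hA, hB, hβ, inner_add_left, inner_add_right,
      real_inner_smul_left, real_inner_smul_right, smul_eq_mul]
    ring
  have hgradΦev : gradient Φ =ᶠ[𝓝 x₁] fun z => A z + B z := by
    filter_upwards [hNo.mem_nhds hx₁N] with z hz using hgradΦ z hz
  -- differentiability at `x₁`
  have hsd1 : DifferentiableAt ℝ s x₁ := (hsd x₁ hx0).differentiableAt
  have hπd1 : DifferentiableAt ℝ π x₁ := (hπ' x₁ hx0).differentiableAt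
  have hvπd : DifferentiableAt ℝ (fun z => v (π z)) x₁ := by
    have := (hvd (π x₁)).comp x₁ hπd1
    exact this
  have hσd : DifferentiableAt ℝ σ x₁ :=
    (differentiableAt_deriv_div_sqrt_norm_sq ρ hx0).mul_const 2
  have hβd : DifferentiableAt ℝ β x₁ := (hvπd.inner ℝ differentiableAt_id).mul hσd
  have hAd : DifferentiableAt ℝ A x₁ := hsd1.smul hvπd
  have hBd : DifferentiableAt ℝ B x₁ := hβd.smul differentiableAt_id
  -- `⟪x₁, curl B x₁⟫ = 0` (radial field)
  have hcurlB : ⟪x₁, curl B x₁⟫ = 0 := inner_curl_smul_id_eq_zero hβd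
  -- `⟪x₁, curl A x₁⟫ = ⟪x₁, curl v x₁⟫`
  have hcurlA : ⟪x₁, curl A x₁⟫ = ⟪x₁, curl v x₁⟫ := by
    have hchain : fderiv ℝ (fun z => v (π z)) x₁ = (fderiv ℝ v x₁).comp (fderiv ℝ π x₁) := by
      have := fderiv_comp x₁ (hvd (π x₁)) hπd1
      rw [hπx] at this
      exact this
    have hcvπ : ⟪x₁, curl (fun z => v (π z)) x₁⟫ = ⟪x₁, curl v x₁⟫ := by
      rw [curl_eq_curlCLM (fun z => v (π z)), hchain, (hπ' x₁ hx0).fderiv, hsx, one_smul,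
        ContinuousLinearMap.comp_add, ContinuousLinearMap.comp_id, comp_smulRight, map_add,
        ← curl_eq_curlCLM, inner_add_right, inner_curlCLM_smulRight_smul_innerSL', add_zero]
    rw [hA, curl_smul hsd1 hvπd, hsx, one_smul, (hsd x₁ hx0).fderiv, inner_add_right, hcvπ,
      inner_curlCLM_smulRight_smul_innerSL', add_zero]
  have hsum : curl (gradient Φ) x₁ = curl A x₁ + curl B x₁ := by
    rw [curl_congr_of_eventuallyEq hgradΦev]
    exact curl_add hAd hBd
  have := congrArg (fun w => ⟪x₁, w⟫) hsum
  simp only [hcurl0, inner_zero_right, inner_add_right, hcurlA, hcurlB, add_zero] at this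
  exact this.symm


/-! ## §4 Case B: the field is radial near the point -/

/-- CASE B.  If `v` is `C¹` and `v z × z = 0` for all `z` near `x`, then `⟪x, curl v x⟫ = 0`: near `x ≠ 0` the field is
`k • id` with `k = ⟪z, v z⟫/‖z‖²` differentiable. [folklore] -/
theorem inner_curl_eq_zero_of_cross_eq_zero_nhds {v : EuclideanSpace ℝ (Fin 3) → EuclideanSpace ℝ (Fin 3)}
    {x : EuclideanSpace ℝ (Fin 3)} (hv : ContDiff ℝ 1 v) (h : ∀ᶠ z in 𝓝 x, cross (v z) z = 0) :
    ⟪x, curl v x⟫ = 0 := by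
  by_cases hx : x = 0
  · rw [hx, inner_zero_left]
  set k : EuclideanSpace ℝ (Fin 3) → ℝ := fun z => ⟪z, v z⟫ / ‖z‖ ^ 2 with hk
  have hid : DifferentiableAt ℝ (fun z : EuclideanSpace ℝ (Fin 3) => z) x := differentiableAt_id
  have hnum : DifferentiableAt ℝ (fun z : EuclideanSpace ℝ (Fin 3) => ⟪z, v z⟫) x :=
    hid.inner ℝ (hv.differentiable one_ne_zero x)
  have hden : DifferentiableAt ℝ (fun z : EuclideanSpace ℝ (Fin 3) => ‖z‖ ^ 2) x := hid.norm_sq ℝ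
  have hkd : DifferentiableAt ℝ k x := by
    have hk' : k = fun z => ⟪z, v z⟫ * (‖z‖ ^ 2)⁻¹ := by
      funext z; simp only [hk, div_eq_mul_inv]
    rw [hk']
    exact hnum.mul (hden.inv (pow_ne_zero _ (norm_ne_zero_iff.2 hx)))
  have hev : v =ᶠ[𝓝 x] fun z => k z • z := by
    filter_upwards [h, compl_singleton_mem_nhds hx] with z hz hz0
    exact eq_smul_of_cross_eq_zero hz0 hz
  rw [curl_congr_of_eventuallyEq hev]
  exact inner_curl_smul_id_eq_zero hkd

/-! ## §5 Assembly: gradient-plus-radial fields are unthreaded (no regularity on the potential or the coefficient) -/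

/-- ★ GRADIENT-PLUS-RADIAL FIELDS ARE UNTHREADED (centre `0`, junk-robust).  If a `C¹` field `v : ℝ³ → ℝ³` is pointwise of the form
`v x = gradient φ x + h x • x` with ARBITRARY `φ, h : ℝ³ → ℝ` (Mathlib's junk `gradient`), then `⟪x, curl v x⟫ = 0` everywhere.  On the
interior `U` of the differentiability set `D` of `φ` this is Case A; by continuity it holds on `closure U`; the complement of `closure U`
is the open set `interior (closure Dᶜ)`, and on `closure Dᶜ` the field is radial (`v = h • id` on `Dᶜ`, a closed condition), Case B.
[folklore] -/
theorem inner_curl_eq_zero_of_eq_gradient_add_smul {φ h : EuclideanSpace ℝ (Fin 3) → ℝ}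
    {v : EuclideanSpace ℝ (Fin 3) → EuclideanSpace ℝ (Fin 3)} (hv : ContDiff ℝ 1 v)
    (hrep : ∀ x, v x = gradient φ x + h x • x) (x : EuclideanSpace ℝ (Fin 3)) : ⟪x, curl v x⟫ = 0 := by
  set D : Set (EuclideanSpace ℝ (Fin 3)) := {z | DifferentiableAt ℝ φ z} with hD
  set U : Set (EuclideanSpace ℝ (Fin 3)) := interior D with hUdef
  -- off `D` the field is radial; the condition is closed
  have hpar : ∀ z, z ∉ D → cross (v z) z = 0 := by
    intro z hz
    rw [hrep z, gradient_eq_zero_of_not_differentiableAt hz, zero_add]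
    exact cross_smul_self_left (h z) z
  have hcont : Continuous fun z => cross (v z) z := by
    have : Continuous fun z => crossCLM (v z) z :=
      (crossCLM.continuous.comp hv.continuous).clm_apply continuous_id
    simpa only [crossCLM_apply] using this
  have hcl : closure Dᶜ ⊆ {z | cross (v z) z = 0} :=
    closure_minimal (fun z hz => hpar z hz) (isClosed_eq hcont continuous_const)
  by_cases hx : x ∈ closure U
  · have hA : ∀ z ∈ U, ⟪z, curl v z⟫ = 0 := by
      intro z hz
      by_cases hz0 : z = 0
      · rw [hz0, inner_zero_left]
      exact inner_curl_eq_zero_of_gradient_repr_nhds (h := h) isOpen_interior hv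
        (fun w hw => interior_subset (s := D) hw) (fun w _ => by rw [hrep w, add_sub_cancel_right]) hz hz0
    have hcl' : closure U ⊆ {z | ⟪z, curl v z⟫ = 0} :=
      closure_minimal hA (isClosed_eq (continuous_id.inner (continuous_curl hv)) continuous_const)
    exact hcl' hx
  · have hW : (closure U)ᶜ ⊆ closure Dᶜ := by
      rw [← interior_compl, hUdef, ← closure_compl]
      exact interior_subset
    have hev : ∀ᶠ z in 𝓝 x, cross (v z) z = 0 := by
      filter_upwards [isClosed_closure.isOpen_compl.mem_nhds hx] with z hz using hcl (hW hz)
    exact inner_curl_eq_zero_of_cross_eq_zero_nhds hv hev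

/-- ★ GRADIENT-PLUS-RADIAL FIELDS ARE UNTHREADED about any centre `x₀` (junk-robust): `v x = gradient φ x + h x • (x − x₀)` pointwise
with arbitrary `φ, h` and `v ∈ C¹` ⇒ `⟪x − x₀, curl v x⟫ = 0` for all `x` (translate to centre `0`; `gradient` and `curl` commute with
translations unconditionally). [folklore] -/
theorem inner_curl_eq_zero_of_eq_gradient_add_smul_sub {φ h : EuclideanSpace ℝ (Fin 3) → ℝ}
    {v : EuclideanSpace ℝ (Fin 3) → EuclideanSpace ℝ (Fin 3)} (x₀ : EuclideanSpace ℝ (Fin 3)) (hv : ContDiff ℝ 1 v)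
    (hrep : ∀ x, v x = gradient φ x + h x • (x - x₀)) (x : EuclideanSpace ℝ (Fin 3)) :
    ⟪x - x₀, curl v x⟫ = 0 := by
  set w : EuclideanSpace ℝ (Fin 3) → EuclideanSpace ℝ (Fin 3) := fun z => v (z + x₀) with hw
  have hwc : ContDiff ℝ 1 w := hv.comp (contDiff_id.add contDiff_const)
  have hrepw : ∀ z, w z = gradient (fun y => φ (y + x₀)) z + h (z + x₀) • z := by
    intro z
    have hg : gradient (fun y => φ (y + x₀)) z = gradient φ (z + x₀) := by
      rw [gradient, gradient, fderiv_comp_add_right]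
    show v (z + x₀) = _
    rw [hg, hrep (z + x₀), add_sub_cancel_right]
  have h1 := inner_curl_eq_zero_of_eq_gradient_add_smul (φ := fun y => φ (y + x₀)) (h := fun z => h (z + x₀)) hwc hrepw
    (x - x₀)
  have hcurl : curl w (x - x₀) = curl v x := by
    rw [curl_eq_curlCLM, curl_eq_curlCLM, hw, fderiv_comp_add_right, sub_add_cancel]
  rwa [hcurl] at h1

end Summit.NavierStokesRegularity.NavierStokesRegularity.Theorems.PoloidalLiouville.Antidynamo

end
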